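import Literature.NumberTheory.EllipticCurves.ModularSymbolsManin
import Summits.BirchSwinnertonDyer.BirchSwinnertonDyer.Theorems.ManinLocalTwoThreePrimeClassGeneration
import HarnessLib

/-!
# The period of a ROW: `{∞, γ∞}_f` as a function of the bottom row of `γ ∈ Γ₀(N)`, and its three exact invariances
# (route `ManinLocalTwoThree`, cell bsd-f2-manin; cruxes C3 `ManinPrimeToThreeAtNine` stmt-BirchSwinnertonDyer-22968,
# C2 `ManinOddAtFour` stmt-BirchSwinnertonDyer-22967; prover seat p3 gen 10 — helper, unconditional)

Vocabulary and lemmas for the sibling file `…DegeneracyLoopLawOfRowMoves.lean`, which REDUCES the cell's degeneracy-loop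
laws E-es-68₉ / E-es-68₈ (`DegeneracyLoopLawNine/Eight`, `…/ManinAdditive/DegeneracyLoopLaws.lean`) to an elementary
connectivity statement about integer rows.

* `rowValid N` — the valid rows `(c, d) ∈ ℤ²`, `N ∣ c`, `gcd(c, d) = 1` (= bottom rows of `Γ₀(N)`, `exists_gamma0_of_rowValid`);
* `rowMoves N t` — the row moves `(c, d) → (c + N k d, d)`, `(c, d) → (c, d + k c)`, `(c, d) → (−c, −d)`, `(t c, d) → (c, d)`
  as a set of ordered pairs of valid rows;
* `cuspSymbol_eq_of_row_eq` — `{∞, γ∞}_f` depends only on the bottom row of `γ ∈ Γ₀(N)` (two such `γ` differ by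
  `a ↦ a + kc`, and `{∞, a/c + k} = {∞, a/c}`); `rowSymbol f c d` := that common value (`rowSymbol_eq_cuspSymbol`,
  `rowSymbol_zero_one`, `gamma0Of`, `rowSymbol_eq_cuspSymbol_gamma0Of`);
* the three EXACT invariances `rowSymbol_lower` (`γ ↦ γ·(1 0; Nk 1)`), `rowSymbol_upper` (`γ ↦ γ·(1 k; 0 1)`),
  `rowSymbol_neg` (`γ ↦ −γ`) — the extra factors are parabolic (or `−1`) with period `0`.

Nothing about BSD, Manin's conjecture or the laws E-es-68 is asserted here.  References: Ju. I. Manin, Izv. 6 (1972),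
Prop. 1.4 / Thm. 1.6 (`γ ↦ {∞, γ∞}` is a homomorphism; `{∞, γr} = {∞, γ∞} + {∞, r}`) [cite: Manin1972, Prop. 1.4 / Thm. 1.6].
-/


set_option autoImplicit false
set_option linter.dupNamespace false

noncomputable section

open scoped Classical MatrixGroups ModularForm

open CongruenceSubgroup Matrix.SpecialLinearGroup
  Literature.NumberTheory.EllipticCurves Literature.NumberTheory.EllipticCurves.ModularForms

namespace Summit.BirchSwinnertonDyer.BirchSwinnertonDyer.Theorems.ManinLocalTwoThree

/-! ### §1. Row moves — the elementary side -/

section Moves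

/-- The **valid rows** at level `N`: pairs `(c, d) ∈ ℤ²` with `N ∣ c` and `gcd(c, d) = 1` — exactly the bottom rows of
the matrices of `Γ₀(N)`. [folklore] -/
def rowValid (N : ℕ) : Set (ℤ × ℤ) :=
  {p | (N : ℤ) ∣ p.1 ∧ IsCoprime p.1 p.2}

/-- Membership in `rowValid`. [folklore] -/
theorem mem_rowValid {N : ℕ} {c d : ℤ} : (c, d) ∈ rowValid N ↔ (N : ℤ) ∣ c ∧ IsCoprime c d := Iff.rfl

/-- The **row moves** at `(N, t)`, as a set of ordered pairs of valid rows `(source, target)`: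
`(c, d) → (c + N k d, d)` (right multiplication by the parabolic `(1 0; Nk 1)`), `(c, d) → (c, d + k c)` (by `(1 k; 0 1)`),
`(c, d) → (−c, −d)` (by `−1`), and the SCALING `(t c, d) → (c, d)` (conjugation by `diag(t, 1)` on `Γ₀(tN)`); both ends
are required valid. [folklore] -/
def rowMoves (N t : ℕ) : Set ((ℤ × ℤ) × (ℤ × ℤ)) :=
  {e | e.1 ∈ rowValid N ∧ e.2 ∈ rowValid N ∧
    ((∃ k : ℤ, e.2 = (e.1.1 + N * k * e.1.2, e.1.2)) ∨ (∃ k : ℤ, e.2 = (e.1.1, e.1.2 + k * e.1.1)) ∨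
      e.2 = (-e.1.1, -e.1.2) ∨ e.1 = ((t : ℤ) * e.2.1, e.2.2))}

/-- Membership in `rowMoves`. [folklore] -/
theorem mem_rowMoves {N t : ℕ} {p q : ℤ × ℤ} : (p, q) ∈ rowMoves N t ↔
    p ∈ rowValid N ∧ q ∈ rowValid N ∧
      ((∃ k : ℤ, q = (p.1 + N * k * p.2, p.2)) ∨ (∃ k : ℤ, q = (p.1, p.2 + k * p.1)) ∨
        q = (-p.1, -p.2) ∨ p = ((t : ℤ) * q.1, q.2)) := Iff.rfl

end Moves

/-! ### §2. The period of a row -/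

section RowSymbol

variable {N : ℕ} [NeZero N] (f : CuspForm (Gamma0 N) 2)

omit [NeZero N] in
/-- A valid row is the bottom row of a matrix of `Γ₀(N)` (Bézout). [folklore] -/
theorem exists_gamma0_of_rowValid {c d : ℤ} (h : (c, d) ∈ rowValid N) :
    ∃ γ : Gamma0 N, ((γ : SL(2, ℤ)) 1 0 : ℤ) = c ∧ ((γ : SL(2, ℤ)) 1 1 : ℤ) = d := by
  obtain ⟨hN, u, v, huv⟩ := mem_rowValid.mp h
  let M : Matrix (Fin 2) (Fin 2) ℤ := !![v, -u; c, d]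
  have hdet : M.det = 1 := by
    rw [Matrix.det_fin_two_of]
    linear_combination huv
  let γ₀ : SL(2, ℤ) := ⟨M, hdet⟩
  have hmem : γ₀ ∈ Gamma0 N := by
    rw [Gamma0_mem]
    show ((c : ℤ) : ZMod N) = 0
    exact (ZMod.intCast_zmod_eq_zero_iff_dvd c N).mpr hN
  exact ⟨⟨γ₀, hmem⟩, rfl, rfl⟩

/-- **`{∞, γ∞}_f` depends only on the bottom row of `γ`**: two matrices of `Γ₀(N)` with the same bottom row `(c, d)`
have `a' = a + kc` (`c ∣ (a' − a)d`, `gcd(c, d) = 1`), so `{∞, a'/c} = {∞, a/c + k} = {∞, a/c}`.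
[cite: Manin1972, Prop. 1.4 / Thm. 1.6] -/
theorem cuspSymbol_eq_of_row_eq (γ γ' : Gamma0 N) (h10 : ((γ' : SL(2, ℤ)) 1 0 : ℤ) = (γ : SL(2, ℤ)) 1 0)
    (h11 : ((γ' : SL(2, ℤ)) 1 1 : ℤ) = (γ : SL(2, ℤ)) 1 1) : cuspSymbol f γ' = cuspSymbol f γ := by
  have hdet : ((γ : SL(2, ℤ)) 0 0 : ℤ) * (γ : SL(2, ℤ)) 1 1 - ((γ : SL(2, ℤ)) 0 1 : ℤ) * (γ : SL(2, ℤ)) 1 0 = 1 := by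
    have := Matrix.det_fin_two ((γ : SL(2, ℤ)) : Matrix (Fin 2) (Fin 2) ℤ)
    rw [(γ : SL(2, ℤ)).2] at this
    exact this.symm
  have hdet' : ((γ' : SL(2, ℤ)) 0 0 : ℤ) * (γ : SL(2, ℤ)) 1 1 - ((γ' : SL(2, ℤ)) 0 1 : ℤ) * (γ : SL(2, ℤ)) 1 0 = 1 := by
    have := Matrix.det_fin_two ((γ' : SL(2, ℤ)) : Matrix (Fin 2) (Fin 2) ℤ)
    rw [(γ' : SL(2, ℤ)).2, h10, h11] at this
    exact this.symm
  unfold cuspSymbol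
  rw [h10]
  by_cases hc0 : ((γ : SL(2, ℤ)) 1 0 : ℤ) = 0
  · rw [if_pos hc0, if_pos hc0]
  · rw [if_neg hc0, if_neg hc0]
    have hcop : IsCoprime ((γ : SL(2, ℤ)) 1 0 : ℤ) ((γ : SL(2, ℤ)) 1 1 : ℤ) :=
      ⟨-((γ : SL(2, ℤ)) 0 1 : ℤ), ((γ : SL(2, ℤ)) 0 0 : ℤ), by linear_combination hdet⟩
    have hdvd : ((γ : SL(2, ℤ)) 1 0 : ℤ) ∣ (((γ' : SL(2, ℤ)) 0 0 : ℤ) - (γ : SL(2, ℤ)) 0 0) * (γ : SL(2, ℤ)) 1 1 :=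
      ⟨((γ' : SL(2, ℤ)) 0 1 : ℤ) - (γ : SL(2, ℤ)) 0 1, by linear_combination hdet' - hdet⟩
    obtain ⟨k, hk⟩ := hcop.dvd_of_dvd_mul_right hdvd
    have hcQ : (((γ : SL(2, ℤ)) 1 0 : ℤ) : ℚ) ≠ 0 := by exact_mod_cast hc0
    have e : ((((γ' : SL(2, ℤ)) 0 0 : ℤ) : ℚ)) / (((γ : SL(2, ℤ)) 1 0 : ℤ) : ℚ) =
        (((γ : SL(2, ℤ)) 0 0 : ℤ) : ℚ) / (((γ : SL(2, ℤ)) 1 0 : ℤ) : ℚ) + (k : ℤ) := by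
      have hk' : (((γ' : SL(2, ℤ)) 0 0 : ℤ) : ℚ) = (((γ : SL(2, ℤ)) 0 0 : ℤ) : ℚ) +
          (((γ : SL(2, ℤ)) 1 0 : ℤ) : ℚ) * (k : ℚ) := by
        exact_mod_cast (show ((γ' : SL(2, ℤ)) 0 0 : ℤ) = (γ : SL(2, ℤ)) 0 0 + (γ : SL(2, ℤ)) 1 0 * k by
          linear_combination hk)
      rw [hk']
      field_simp
    rw [e, modularSymbol_add_intCast_holds f]

/-- **The period of a valid row** `(c, d)`: `{∞, γ∞}_f` for any `γ ∈ Γ₀(N)` with bottom row `(c, d)` (well defined by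
`cuspSymbol_eq_of_row_eq`); junk value `0` on invalid rows. [folklore] -/
def rowSymbol (c d : ℤ) : ℂ :=
  if h : ∃ γ : Gamma0 N, ((γ : SL(2, ℤ)) 1 0 : ℤ) = c ∧ ((γ : SL(2, ℤ)) 1 1 : ℤ) = d then
    cuspSymbol f h.choose else 0

/-- `rowSymbol` at the bottom row of `γ` is `{∞, γ∞}_f`. [folklore] -/
theorem rowSymbol_eq_cuspSymbol (γ : Gamma0 N) :
    rowSymbol f ((γ : SL(2, ℤ)) 1 0) ((γ : SL(2, ℤ)) 1 1) = cuspSymbol f γ := by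
  have h : ∃ γ' : Gamma0 N, ((γ' : SL(2, ℤ)) 1 0 : ℤ) = (γ : SL(2, ℤ)) 1 0 ∧
      ((γ' : SL(2, ℤ)) 1 1 : ℤ) = (γ : SL(2, ℤ)) 1 1 := ⟨γ, rfl, rfl⟩
  rw [rowSymbol, dif_pos h]
  exact cuspSymbol_eq_of_row_eq f γ h.choose h.choose_spec.1 h.choose_spec.2

/-- `rowSymbol f 0 1 = {∞, ∞}_f = 0`. [folklore] -/
theorem rowSymbol_zero_one : rowSymbol f 0 1 = 0 := by
  have h := rowSymbol_eq_cuspSymbol f (1 : Gamma0 N)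
  have e10 : (((1 : Gamma0 N) : SL(2, ℤ)) 1 0 : ℤ) = 0 := by simp
  have e11 : (((1 : Gamma0 N) : SL(2, ℤ)) 1 1 : ℤ) = 1 := by simp
  rw [e10, e11] at h
  rw [h]
  unfold cuspSymbol
  rw [if_pos e10]

/-- An explicit matrix of `Γ₀(N)` from four integers with `a d − b c = 1`, `N ∣ c`. [folklore] -/
def gamma0Of (a b c d : ℤ) (hdet : a * d - b * c = 1) (hc : (N : ℤ) ∣ c) : Gamma0 N :=
  ⟨⟨!![a, b; c, d], by rw [Matrix.det_fin_two_of]; linear_combination hdet⟩, by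
    rw [Gamma0_mem]
    show ((c : ℤ) : ZMod N) = 0
    exact (ZMod.intCast_zmod_eq_zero_iff_dvd c N).mpr hc⟩

omit [NeZero N] in
/-- Entries of `gamma0Of`. [folklore] -/
theorem gamma0Of_apply (a b c d : ℤ) (hdet : a * d - b * c = 1) (hc : (N : ℤ) ∣ c) :
    (((gamma0Of a b c d hdet hc : Gamma0 N) : SL(2, ℤ)) 0 0 : ℤ) = a ∧
    (((gamma0Of a b c d hdet hc : Gamma0 N) : SL(2, ℤ)) 0 1 : ℤ) = b ∧
    (((gamma0Of a b c d hdet hc : Gamma0 N) : SL(2, ℤ)) 1 0 : ℤ) = c ∧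
    (((gamma0Of a b c d hdet hc : Gamma0 N) : SL(2, ℤ)) 1 1 : ℤ) = d :=
  ⟨rfl, rfl, rfl, rfl⟩

/-- `rowSymbol` of an explicit matrix. [folklore] -/
theorem rowSymbol_eq_cuspSymbol_gamma0Of (a b c d : ℤ) (hdet : a * d - b * c = 1) (hc : (N : ℤ) ∣ c) :
    rowSymbol f c d = cuspSymbol f (gamma0Of a b c d hdet hc) := by
  have h := rowSymbol_eq_cuspSymbol f (gamma0Of a b c d hdet hc)
  obtain ⟨-, -, e10, e11⟩ := gamma0Of_apply (N := N) a b c d hdet hc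
  rwa [e10, e11] at h

/-! ### §3. The three exact invariances -/

omit [NeZero N] in
/-- Bottom row of a product `γ δ`. [folklore] -/
private theorem mul_apply_one (γ δ : Gamma0 N) :
    (((γ * δ : Gamma0 N) : SL(2, ℤ)) 1 0 : ℤ) =
        (γ : SL(2, ℤ)) 1 0 * (δ : SL(2, ℤ)) 0 0 + (γ : SL(2, ℤ)) 1 1 * (δ : SL(2, ℤ)) 1 0 ∧
      (((γ * δ : Gamma0 N) : SL(2, ℤ)) 1 1 : ℤ) =
        (γ : SL(2, ℤ)) 1 0 * (δ : SL(2, ℤ)) 0 1 + (γ : SL(2, ℤ)) 1 1 * (δ : SL(2, ℤ)) 1 1 := by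
  constructor <;> simp [Matrix.mul_apply, Fin.sum_univ_two]

/-- **Lower move**: `rowSymbol f (c + N k d) d = rowSymbol f c d` — right multiplication by the parabolic
`u = (1 0; Nk 1)`, whose period `{∞, u·0} − {∞, 0} = 0` vanishes (`u` fixes the cusp `0`). [cite: Manin1972, Prop. 1.4 / Thm. 1.6] -/
theorem rowSymbol_lower {c d : ℤ} (h : (c, d) ∈ rowValid N) (k : ℤ) :
    rowSymbol f (c + N * k * d) d = rowSymbol f c d := by
  obtain ⟨γ, h10, h11⟩ := exists_gamma0_of_rowValid h
  have hu : (1 : ℤ) * 1 - 0 * ((N : ℤ) * k) = 1 := by ring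
  obtain ⟨u00, u01, u10, u11⟩ := gamma0Of_apply (N := N) 1 0 ((N : ℤ) * k) 1 hu (Dvd.intro k rfl)
  obtain ⟨m10, m11⟩ := mul_apply_one γ (gamma0Of 1 0 ((N : ℤ) * k) 1 hu (Dvd.intro k rfl))
  rw [u00, u10, h10, h11] at m10
  rw [u01, u11, h10, h11] at m11
  have hper : cuspSymbol f (gamma0Of 1 0 ((N : ℤ) * k) 1 hu (Dvd.intro k rfl) : Gamma0 N) = 0 := by
    rw [cuspSymbol_eq_modularSymbol_div_sub f _ (by rw [u11]; exact one_ne_zero), u01, u11]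
    simp
  calc rowSymbol f (c + N * k * d) d
      = rowSymbol f (((γ * gamma0Of 1 0 ((N : ℤ) * k) 1 hu (Dvd.intro k rfl) : Gamma0 N) : SL(2, ℤ)) 1 0)
          (((γ * gamma0Of 1 0 ((N : ℤ) * k) 1 hu (Dvd.intro k rfl) : Gamma0 N) : SL(2, ℤ)) 1 1) := by
        rw [m10, m11]; congr 1 <;> ring
    _ = cuspSymbol f γ := by rw [rowSymbol_eq_cuspSymbol, cuspSymbol_mul_holds f, hper, add_zero]
    _ = rowSymbol f c d := by rw [← rowSymbol_eq_cuspSymbol f γ, h10, h11]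

/-- **Upper move**: `rowSymbol f c (d + k c) = rowSymbol f c d` — right multiplication by `T^k = (1 k; 0 1)`, whose
period vanishes (`T^k ∞ = ∞`). [cite: Manin1972, Prop. 1.4 / Thm. 1.6] -/
theorem rowSymbol_upper {c d : ℤ} (h : (c, d) ∈ rowValid N) (k : ℤ) :
    rowSymbol f c (d + k * c) = rowSymbol f c d := by
  obtain ⟨γ, h10, h11⟩ := exists_gamma0_of_rowValid h
  have hT : (1 : ℤ) * 1 - k * 0 = 1 := by ring
  obtain ⟨t00, t01, t10, t11⟩ := gamma0Of_apply (N := N) 1 k 0 1 hT (dvd_zero _)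
  obtain ⟨m10, m11⟩ := mul_apply_one γ (gamma0Of 1 k 0 1 hT (dvd_zero _))
  rw [t00, t10, h10, h11] at m10
  rw [t01, t11, h10, h11] at m11
  have hper : cuspSymbol f (gamma0Of 1 k 0 1 hT (dvd_zero _) : Gamma0 N) = 0 := by
    unfold cuspSymbol
    rw [if_pos t10]
  calc rowSymbol f c (d + k * c)
      = rowSymbol f (((γ * gamma0Of 1 k 0 1 hT (dvd_zero _) : Gamma0 N) : SL(2, ℤ)) 1 0)
          (((γ * gamma0Of 1 k 0 1 hT (dvd_zero _) : Gamma0 N) : SL(2, ℤ)) 1 1) := by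
        rw [m10, m11]; congr 1 <;> ring
    _ = cuspSymbol f γ := by rw [rowSymbol_eq_cuspSymbol, cuspSymbol_mul_holds f, hper, add_zero]
    _ = rowSymbol f c d := by rw [← rowSymbol_eq_cuspSymbol f γ, h10, h11]

/-- **Sign move**: `rowSymbol f (−c) (−d) = rowSymbol f c d` (`(−a)/(−c) = a/c`). [folklore] -/
theorem rowSymbol_neg {c d : ℤ} (h : (c, d) ∈ rowValid N) :
    rowSymbol f (-c) (-d) = rowSymbol f c d := by
  obtain ⟨γ, h10, h11⟩ := exists_gamma0_of_rowValid h
  have hmem : -(γ : SL(2, ℤ)) ∈ Gamma0 N := by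
    have hh := Gamma0_mem.mp γ.2
    rw [Gamma0_mem]
    simp only [Matrix.SpecialLinearGroup.coe_neg, Matrix.neg_apply, Int.cast_neg, hh, neg_zero]
  have e10 : (((⟨-(γ : SL(2, ℤ)), hmem⟩ : Gamma0 N) : SL(2, ℤ)) 1 0 : ℤ) = -c := by
    simp [Matrix.SpecialLinearGroup.coe_neg, h10]
  have e11 : (((⟨-(γ : SL(2, ℤ)), hmem⟩ : Gamma0 N) : SL(2, ℤ)) 1 1 : ℤ) = -d := by
    simp [Matrix.SpecialLinearGroup.coe_neg, h11]
  calc rowSymbol f (-c) (-d)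
      = rowSymbol f (((⟨-(γ : SL(2, ℤ)), hmem⟩ : Gamma0 N) : SL(2, ℤ)) 1 0)
          (((⟨-(γ : SL(2, ℤ)), hmem⟩ : Gamma0 N) : SL(2, ℤ)) 1 1) := by rw [e10, e11]
    _ = cuspSymbol f ⟨-(γ : SL(2, ℤ)), hmem⟩ := rowSymbol_eq_cuspSymbol f _
    _ = cuspSymbol f γ := by
        rw [cuspSymbol_eq_inftySymbol, cuspSymbol_eq_inftySymbol]
        exact inftySymbol_neg f (γ : SL(2, ℤ))
    _ = rowSymbol f c d := by rw [← rowSymbol_eq_cuspSymbol f γ, h10, h11]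

end RowSymbol

end Summit.BirchSwinnertonDyer.BirchSwinnertonDyer.Theorems.ManinLocalTwoThree

end
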